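import Summits.RiemannHypothesis.RiemannHypothesis.Theorems.MotivicDoorAWSStructure
import Literature.NumberTheory.LFunctions.WeilWindowSimpleEven

/-!
# Prime-side skeleton, part 1: the real-combination calculus of a generating family

AWS sprint (cell `pub-rhdoor`, seat cc-4), support file for `AWS/Skeleton` (the AXIOM-CONTENT
audit).
HONEST LABEL: the sprint theorem `Nonempty ArithmeticWeilSurface → RH` is a one-way implication from
a strengthened, prime-side-only axiom system; the existence of such an object is NOT claimed and is
the located gap (`AWS/Skeleton` shows satisfiability is EQUIVALENT to RH).  Framing: lottery ticket
at the motivic door; RH probability negligible; consolation prizes are real: a new semi-local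
Weil-positivity theorem, or a located gap in the Connes–Consani programme, plus the ff-door theorem.

Content (PROVED, real analysis only — no zeros of `ζ`, no positivity): for a generating family `G`
and a finitely supported REAL coefficient vector `r : G.ι →₀ ℝ`, the complexified combination
`U_r = Σ r_i φ_i` (`GeneratingFamily.combC`, a Weil test), its prime-side numbers
`m⋆(r) = ∫ f_r d*u`, `m(r) = ∫ f_r du` (`mStar`, `mU`), the cross functional `W(U_r ⋆ Ũ_{r'})`
(`cross`) and the decreed Gram number `B(r,r') = m⋆(r)m(r') + m(r)m⋆(r') − Re W(U_r ⋆ Ũ_{r'})`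
(`gram`, the polarisation of the axiom `D(u_c)² = 2𝔰(f_c,f_c)`), with their additivity,
`ℝ`-homogeneity and symmetry (from `weilConv_add_left/right`, `weilFunctional_add`,
`weilMellin_add`, `…_const_mul`, `weilFunctional_weilConv_weilReflect_swap_of_real`), and the
identification of integer combinations `U_ĉ = u_c` (`linearCombination_intComb`).
Refs: A. Weil (1952); E. Bombieri (2000) §3; Connes–Consani arXiv:1805.10501 §3.1.
-/

noncomputable section

open Complex Set MeasureTheory Literature.NumberTheory.LFunctions
open Literature.NumberTheory.ConnesConsani2019
open Summit.RiemannHypothesis.RiemannHypothesis.Theorems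
open Summit.RiemannHypothesis.RiemannHypothesis.Theorems.MotivicDoor.ConnesConsani
open scoped ComplexConjugate

namespace Summit.RiemannHypothesis.RiemannHypothesis.Theorems.MotivicDoor.AWS

namespace GeneratingFamily

variable (G : GeneratingFamily)

/-- The complexified real combination `U_r = Σ_i r_i φ_i` of the generators. -/
def combC (r : G.ι →₀ ℝ) : ℝ → ℂ := fun t ↦ ((Finsupp.linearCombination ℝ G.φ r) t : ℂ)

/-- A real combination of the generators is a Weil test function. -/
theorem isWeilTest_combC (r : G.ι →₀ ℝ) : IsWeilTest (G.combC r) := by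
  classical
  have key : ∀ s : Finset G.ι,
      IsWeilTest fun t ↦ ∑ i ∈ s, ((r i : ℝ) : ℂ) * (G.φ i t : ℂ) := by
    intro s
    induction s using Finset.induction_on with
    | empty =>
      simp only [Finset.sum_empty]
      change IsWeilTest (0 : ℝ → ℂ)
      exact ⟨contDiff_const, HasCompactSupport.zero⟩
    | insert i s hi ih =>
      simpa [Finset.sum_insert hi, Pi.add_def] using
        ((G.isWeilTest i).const_mul ((r i : ℝ) : ℂ)).add ih
  convert key r.support using 2 with t
  simp [combC, Finsupp.linearCombination_apply, Finsupp.sum, Finset.sum_apply, Complex.ofReal_sum]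

/-- Additivity of `r ↦ U_r`. -/
theorem combC_add (r r' : G.ι →₀ ℝ) : G.combC (r + r') = G.combC r + G.combC r' := by
  funext t
  simp [combC, map_add]

/-- Homogeneity of `r ↦ U_r`. -/
theorem combC_smul (a : ℝ) (r : G.ι →₀ ℝ) : G.combC (a • r) = fun t ↦ (a : ℂ) * G.combC r t := by
  funext t
  simp [combC, map_smul]

/-- `U_r` is real-valued. -/
theorem conj_combC (r : G.ι →₀ ℝ) (t : ℝ) : conj (G.combC r t) = G.combC r t :=
  Complex.conj_ofReal _

/-- Integer combinations are real combinations: `U_ĉ = u_c`, `ĉ = Σ c_i δ_i`. -/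
theorem linearCombination_intComb (c : G.ι →₀ ℤ) :
    Finsupp.linearCombination ℝ G.φ (c.sum fun i n ↦ Finsupp.single i (n : ℝ)) =
      testCombination G.φ c := by
  funext t
  rw [map_finsuppSum]
  simp only [Finsupp.linearCombination_single, testCombination]
  simp only [Finsupp.sum, Finset.sum_apply, Pi.smul_apply, smul_eq_mul]

/-- The same, complexified. -/
theorem combC_intComb (c : G.ι →₀ ℤ) :
    G.combC (c.sum fun i n ↦ Finsupp.single i (n : ℝ)) = fun t ↦ (testCombination G.φ c t : ℂ) := by
  funext t
  simp only [combC, linearCombination_intComb]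

/-- An integer combination of the generators is a Weil test function. -/
theorem isWeilTest_coe_testCombination (c : G.ι →₀ ℤ) :
    IsWeilTest fun t ↦ (testCombination G.φ c t : ℂ) := by
  rw [← combC_intComb]
  exact G.isWeilTest_combC _


/-- `m⋆(r) := ∫ f_r d*u`, `f_r = toMul U_r`. -/
def mStar (r : G.ι →₀ ℝ) : ℝ := massDstar (toMul (Finsupp.linearCombination ℝ G.φ r))

/-- `m(r) := ∫ f_r du`. -/
def mU (r : G.ι →₀ ℝ) : ℝ := massDu (toMul (Finsupp.linearCombination ℝ G.φ r))

/-- The cross functional `W(U_r ⋆ Ũ_{r'})`. -/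
def cross (r r' : G.ι →₀ ℝ) : ℂ := weilFunctional (weilConv (G.combC r) (weilReflect (G.combC r')))

/-- `m⋆(r) = Û_r(0)`. -/
theorem ofReal_mStar (r : G.ι →₀ ℝ) : (G.mStar r : ℂ) = weilMellin (G.combC r) 0 :=
  (weilMellin_zero_eq_massDstar _).symm

/-- `m(r) = Û_r(1)`. -/
theorem ofReal_mU (r : G.ι →₀ ℝ) : (G.mU r : ℂ) = weilMellin (G.combC r) 1 :=
  (weilMellin_one_eq_massDu _).symm

/-- Additivity of `r ↦ Û_r(s)`. -/
theorem weilMellin_combC_add (r r' : G.ι →₀ ℝ) (s : ℂ) :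
    weilMellin (G.combC (r + r')) s = weilMellin (G.combC r) s + weilMellin (G.combC r') s := by
  rw [combC_add]
  exact weilMellin_add (G.isWeilTest_combC r).1.continuous (G.isWeilTest_combC r).2
    (G.isWeilTest_combC r').1.continuous (G.isWeilTest_combC r').2 s

/-- Homogeneity of `r ↦ Û_r(s)`. -/
theorem weilMellin_combC_smul (a : ℝ) (r : G.ι →₀ ℝ) (s : ℂ) :
    weilMellin (G.combC (a • r)) s = (a : ℂ) * weilMellin (G.combC r) s := by
  rw [combC_smul, weilMellin_const_mul]

/-- Additivity of `m⋆`. -/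
theorem mStar_add (r r' : G.ι →₀ ℝ) : G.mStar (r + r') = G.mStar r + G.mStar r' := by
  exact_mod_cast (show (G.mStar (r + r') : ℂ) = G.mStar r + G.mStar r' by
    simp only [ofReal_mStar, weilMellin_combC_add])

/-- Homogeneity of `m⋆`. -/
theorem mStar_smul (a : ℝ) (r : G.ι →₀ ℝ) : G.mStar (a • r) = a * G.mStar r := by
  exact_mod_cast (show (G.mStar (a • r) : ℂ) = (a : ℂ) * G.mStar r by
    simp only [ofReal_mStar, weilMellin_combC_smul])

/-- Additivity of `m`. -/
theorem mU_add (r r' : G.ι →₀ ℝ) : G.mU (r + r') = G.mU r + G.mU r' := by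
  exact_mod_cast (show (G.mU (r + r') : ℂ) = G.mU r + G.mU r' by
    simp only [ofReal_mU, weilMellin_combC_add])

/-- Homogeneity of `m`. -/
theorem mU_smul (a : ℝ) (r : G.ι →₀ ℝ) : G.mU (a • r) = a * G.mU r := by
  exact_mod_cast (show (G.mU (a • r) : ℂ) = (a : ℂ) * G.mU r by
    simp only [ofReal_mU, weilMellin_combC_smul])

/-- `m⋆(0) = 0`. -/
theorem mStar_zero : G.mStar 0 = 0 := by simpa using G.mStar_smul 0 0

/-- `m(0) = 0`. -/
theorem mU_zero : G.mU 0 = 0 := by simpa using G.mU_smul 0 0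

/-- The diagonal of the cross functional is Weil's quadratic form `Q`. -/
theorem cross_self (r : G.ι →₀ ℝ) : G.cross r r = weilQuadratic (G.combC r) := rfl

/-- Additivity of the cross functional in the first slot. -/
theorem cross_add_left (r r' r'' : G.ι →₀ ℝ) :
    G.cross (r + r') r'' = G.cross r r'' + G.cross r' r'' := by
  unfold cross
  rw [combC_add, weilConv_add_left (G.isWeilTest_combC r) (G.isWeilTest_combC r')
      (G.isWeilTest_combC r'').weilReflect,
    weilFunctional_add ((G.isWeilTest_combC r).weilConv (G.isWeilTest_combC r'').weilReflect)
      ((G.isWeilTest_combC r').weilConv (G.isWeilTest_combC r'').weilReflect)]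

/-- Additivity of the cross functional in the second slot. -/
theorem cross_add_right (r r' r'' : G.ι →₀ ℝ) :
    G.cross r (r' + r'') = G.cross r r' + G.cross r r'' := by
  unfold cross
  rw [combC_add, weilReflect_add, weilConv_add_right (G.isWeilTest_combC r)
      (G.isWeilTest_combC r').weilReflect (G.isWeilTest_combC r'').weilReflect,
    weilFunctional_add ((G.isWeilTest_combC r).weilConv (G.isWeilTest_combC r').weilReflect)
      ((G.isWeilTest_combC r).weilConv (G.isWeilTest_combC r'').weilReflect)]

/-- Homogeneity of the cross functional in the first slot. -/
theorem cross_smul_left (a : ℝ) (r r' : G.ι →₀ ℝ) :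
    G.cross (a • r) r' = (a : ℂ) * G.cross r r' := by
  unfold cross
  rw [combC_smul, weilConv_const_mul_left, weilFunctional_const_mul]

/-- Homogeneity in the second slot (real scalars: `conj a = a`). -/
theorem cross_smul_right (a : ℝ) (r r' : G.ι →₀ ℝ) :
    G.cross r (a • r') = (a : ℂ) * G.cross r r' := by
  unfold cross
  rw [combC_smul, weilReflect_const_mul, Complex.conj_ofReal, weilConv_const_mul_right,
    weilFunctional_const_mul]

/-- Symmetry of the cross functional (reality swap; `W` even). -/
theorem cross_comm (r r' : G.ι →₀ ℝ) : G.cross r r' = G.cross r' r :=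
  weilFunctional_weilConv_weilReflect_swap_of_real (u := G.combC r') (v := G.combC r)
    (G.conj_combC r') (G.conj_combC r)


/-- The Gram number `B(r,r') := m⋆(r) m(r') + m(r) m⋆(r') − Re W(U_r ⋆ Ũ_{r'})` — the polarisation
of the prime-side axiom `D(u_c)·D(u_c) = 2𝔰(f_c, f_c) = 2 m⋆ m − Re Q(u_c)`. -/
def gram (r r' : G.ι →₀ ℝ) : ℝ := G.mStar r * G.mU r' + G.mU r * G.mStar r' - (G.cross r r').re

/-- Additivity of `B` in the first slot. -/
theorem gram_add_left (r r' r'' : G.ι →₀ ℝ) :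
    G.gram (r + r') r'' = G.gram r r'' + G.gram r' r'' := by
  simp only [gram, mStar_add, mU_add, cross_add_left, Complex.add_re]; ring

/-- Additivity of `B` in the second slot. -/
theorem gram_add_right (r r' r'' : G.ι →₀ ℝ) :
    G.gram r (r' + r'') = G.gram r r' + G.gram r r'' := by
  simp only [gram, mStar_add, mU_add, cross_add_right, Complex.add_re]; ring

/-- Homogeneity of `B` in the first slot. -/
theorem gram_smul_left (a : ℝ) (r r' : G.ι →₀ ℝ) : G.gram (a • r) r' = a * G.gram r r' := by
  simp only [gram, mStar_smul, mU_smul, cross_smul_left, Complex.re_ofReal_mul]; ring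

/-- Homogeneity of `B` in the second slot. -/
theorem gram_smul_right (a : ℝ) (r r' : G.ι →₀ ℝ) : G.gram r (a • r') = a * G.gram r r' := by
  simp only [gram, mStar_smul, mU_smul, cross_smul_right, Complex.re_ofReal_mul]; ring

/-- Symmetry of `B`. -/
theorem gram_comm (r r' : G.ι →₀ ℝ) : G.gram r r' = G.gram r' r := by
  rw [gram, gram, cross_comm]; ring

/-- `B(0,r) = 0`. -/
theorem gram_zero_left (r : G.ι →₀ ℝ) : G.gram 0 r = 0 := by simpa using G.gram_smul_left 0 0 r

/-- `B(r,0) = 0`. -/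
theorem gram_zero_right (r : G.ι →₀ ℝ) : G.gram r 0 = 0 := by simpa using G.gram_smul_right 0 r 0

/-- The diagonal Gram number is `2 m⋆ m − Re Q(U_r)`. -/
theorem gram_self (r : G.ι →₀ ℝ) :
    G.gram r r = 2 * (G.mStar r * G.mU r) - (weilQuadratic (G.combC r)).re := by
  rw [gram, cross_self]; ring

end GeneratingFamily

end Summit.RiemannHypothesis.RiemannHypothesis.Theorems.MotivicDoor.AWS

end
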